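import Summits.QuantumFields.BalabanUV.Beta.GAN24.DiagramVolumeLimitAlgebra

/-!
# `BalabanUV.Beta.GAN24.DiagramVolumeLimitPairs` — binder row G-an2-4 ∕ (CONV-C), route R7 «TWO CURRENCIES», PART 142: ENTRY LIMITS AT PAIRS OF INTEGER SITES WITHOUT SHIFT INVARIANCE —
# a generic TANNERY OVER THE WINDOW (one torus sum of ANY volume-indexed integrand converging at integer readings under a summable window majorant), the window-distance inequality
# `|windowMap(w − ẑ)|₁ ≥ |windowMap w|₁ − 3|z|₁`, and the PRODUCT CLOSURE of pair entry limits (EL₂: `∀ μ ν z z′, X_t(e(ẑ,μ), e(ẑ′,ν))` converges) given a volume-uniform bound on one factor and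
# volume-uniform window decay of the other — NO translation invariance (the currency of backgrounds `U ≠ 1` and of local vertices).  Socket (§4–§5): for ANY volume-indexed family of
# VERTEX KERNELS `D_t k` on the unit index sets with (UD)+(SR) in `distK` (volume-free) and EL₂, the sandwich `Σ_k·D_t k·Σ_k` of the effective form has the β-cell's whole `LimitRate` END on `ℤ^d`
# (`d ≥ 3`, `L ≥ 2`, `a > 0`, `μ ≠ ν`, even cubic volumes) — the shape of the u-derivative sector `Σ̇ = −c⁻¹ċc⁻¹` and of vertex insertions, with the vertex the ONLY displayed input
# (unit b2b-balaban-gan24-p3, gen 54; v1)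

NOT IN PRINT; OUR PROOF ([folklore] bookkeeping BY NAME over PART 137 (`sum_eq_tsum_window`), the β-cell's `Beta.InfiniteVolume` window dictionary, `B12Sec2to5.summable_exp_neg_l1`, Mathlib's
`tendsto_tsum_of_dominated_convergence`, PARTs 141 ∕ 140 ∕ 134 ∕ 132 ∕ 130 ∕ 127; [Balaban1987RG1] (1.21)–(1.22) p. 264 LOCATE the shapes; nothing printed is a hypothesis).
HONEST FRAMING (cell contract, verbatim): «discharging `BetaPertH` makes Bałaban's UV stability UNCONDITIONAL — a real constructive-QFT result; it is NOT the
continuum limit and NOT the Clay problem.»  HONEST DEPENDENCY (verbatim): «continuum YM on T⁴ ⇐ BetaPertH ∧ nine spine estimates (0/9 proved); BetaPertH ⇐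
(D1) ∧ (D4) ∧ CAP+tail; G-an2-4 gates asym, D1 and NE2/3/4.»

WHAT THIS FILE PROVES (0 sorry, 0 `def`; `e = (unitIdx L (cubic d s))⁻¹`, `ẑ` the reading of `z ∈ ℤ^d`):
* §1 **`tendsto_sum_window`** — TANNERY OVER THE WINDOW: `side t → ∞`, `F_t(ŷ_t) → F_∞(y)` for every `y ∈ ℤ^d`, `‖F_t(w)‖ ≤ bound (windowMap w)` with `bound ≥ 0` summable ⟹ `Σ_w F_t(w) → Σ'_y F_∞(y)`.
* §2 `abs_symmRep_sub_ge` (`|y − u| − 2|u| ≤ |symmRep ((y − u) mod s)|` for `y` in the window), **`l1_windowMap_sub_castT_ge`** (`|windowMap w|₁ − 3|z|₁ ≤ |windowMap (w − ẑ)|₁`).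
* §3 **`tendsto_mul_entry_pair`** — EL₂ OF PRODUCTS: `‖X_t(e(x,μ),e(w,λ))‖ ≤ B`, `‖Y_t(e(w,λ),e(y,ν))‖ ≤ C·e^{−δ|windowMap(w − y)|₁}` (`δ > 0`), EL₂(X_t), EL₂(Y_t) ⟹ EL₂(X_t·Y_t); and the mirrored
  `tendsto_mul_entry_pair'` (decay of the LEFT factor `‖X_t(e(x,μ),e(w,λ))‖ ≤ C·e^{−δ|windowMap(w − x)|₁}`, right factor bounded).
* §4 the effective form at pairs: `tdist_eq_tdist_sub_zero`, `norm_le_exp_window_of_entryDecay` ((UD) in `distK` ⟹ window decay at PAIRS), `effForm_pair_bounds` (bound `Bs` and window decay at all pairs).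
* §5 **`conv_sandwich_effForm_of_vertex`** — THE VERTEX SOCKET: any `D_t k` with (UD) `EntryDecay distK (D_t k) B_D κ_D`, (SR) `TwoLevelDecayRate distK (D_t ·) B_D′ κ_D (√(L⁻¹))` (volume-free) and EL₂
  ⟹ `Σ_k·D_t k·Σ_k` has limit kernels `Π_k` (`IsInfiniteVolumeLimit`), `UniformDecay`, `StepRate (√(L⁻¹))`, `KernelInputs d Π`, `|secondMoment (Π k) − secondMoment Π_∞| ≤ c₀(√(L⁻¹))^k` — constants from
  `(d, L, a, B_D, B_D′, κ_D)`.
NOT DONE: any vertex (row an1's dictionary; the fine-level `ċ_k` needs the fine-torus twin of §3); legs on the pair lattice; `d ≤ 2`, odd volumes.  SUPPLIER work; NEVER «G-an2-4 closed»;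
NOT (CONV-C), NOT D1, NOT `BetaPertH`, NOT continuum, NOT Clay.  Records: `HOME/b2b-balaban-gan24-p3/gen54/README.md`.
-/

noncomputable section

open scoped BigOperators ComplexConjugate Matrix Matrix.Norms.L2Operator
open Filter Topology

namespace Summit.QuantumFields.BalabanUV.Beta.GAN24.DiagramVolumeLimitPairs

open Literature.MathematicalPhysics.QuantumFieldTheory.Balaban1983to89
open Literature.MathematicalPhysics.QuantumFieldTheory.Balaban1983to89.B5Prop11Plancherel (Tor fine)
open Literature.MathematicalPhysics.QuantumFieldTheory.Balaban1983to89.B12Sec2to5 (l1 betaPrime510 summable_exp_neg_l1)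
open Literature.MathematicalPhysics.QuantumFieldTheory.Balaban1983to89.Beta (Site symmRep InWindow windowMap siteOf IsInfiniteVolumeLimit intCast_symmRep two_mul_abs_symmRep_le
  inWindow_windowMap windowMap_siteOf eventually_inWindow)
open Literature.MathematicalPhysics.QuantumFieldTheory.Balaban1983to89.Beta.FreeLegDictionary (cubic)
open Literature.MathematicalPhysics.QuantumFieldTheory.Balaban1983to89.Beta.BlockKernelVolumeSockets (evenPeriod tendsto_evenPeriod)
open Literature.MathematicalPhysics.QuantumFieldTheory.Balaban1983to89.Beta.VectorTails (castT)
open Literature.MathematicalPhysics.QuantumFieldTheory.Balaban1983to89.Beta.VectorTailsCov (tdist)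
open Literature.MathematicalPhysics.QuantumFieldTheory.Balaban1983to89.Beta.LimitRate (StepRate limKernelOf KernelInputs)
open Summit.QuantumFields.BalabanUV.T4Continuum
open Summit.QuantumFields.BalabanUV.T4Continuum.BalabanAveragedTowerUnit (idx unitCovB)
open Summit.QuantumFields.BalabanUV.T4Continuum.BalabanAveragedCoerciveTower (unitIdx)
open Summit.QuantumFields.BalabanUV.T4Continuum.CTKingTowerWeights (distK)
open Summit.QuantumFields.BalabanUV.T4Continuum.DecayRateInterpolation (EntryDecay TwoLevelDecayRate)
open Summit.QuantumFields.BalabanUV.Beta.GAN24.DiagramDecayAlgebra (twoLevelDecayRate_mul entryDecay_mul_tower)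
open Summit.QuantumFields.BalabanUV.Beta.GAN24.UnitLatticeDecayAlgebra (sum_exp_distK_le distK_nonneg distK_triangle)
open Summit.QuantumFields.BalabanUV.Beta.GAN24.DiagramDecayTorus (decay_effForm)
open Summit.QuantumFields.BalabanUV.Beta.GAN24.DiagramDecayWindow (distK_unitIdx_symm exp_distK_le_exp_window)
open Summit.QuantumFields.BalabanUV.Beta.GAN24.VolumeLimitInverse (sum_eq_tsum_window)
open Summit.QuantumFields.BalabanUV.Beta.GAN24.DiagramVolumeLimit (conv_of_decay_of_tendsto tendsto_effForm_entry)
open Summit.QuantumFields.BalabanUV.Beta.GAN24.DiagramVolumeLimitAlgebra (sum_idx_eq_sum_site)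

variable {d : ℕ}

/-! ## §1 Tannery over the window -/

section Window

variable {side : ℕ → ℕ} [∀ t, NeZero (side t)]

/-- **`tendsto_sum_window` — TANNERY OVER THE WINDOW** [folklore]: along `side t → ∞`, a volume-indexed integrand `F_t : Site d (side t) → ℂ` converging at every integer reading
(`F_t(ŷ_t) → F_∞(y)`) under a volume-uniform window majorant `‖F_t(w)‖ ≤ bound (windowMap w)`, `bound ≥ 0` summable on `ℤ^d`, has `Σ_w F_t(w) → Σ'_y F_∞(y)` (dominated convergence on `ℤ^d` for
the zero extensions through the window, PART 137's `sum_eq_tsum_window`). -/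
theorem tendsto_sum_window (hside : Tendsto side atTop atTop) {F : (t : ℕ) → Site d (side t) → ℂ} {Finf : (Fin d → ℤ) → ℂ}
    (hF : ∀ y : Fin d → ℤ, Tendsto (fun t => F t (fun i => (y i : ZMod (side t)))) atTop (𝓝 (Finf y)))
    {bound : (Fin d → ℤ) → ℝ} (hsum : Summable bound) (hb0 : ∀ y, 0 ≤ bound y) (hbd : ∀ t (w : Site d (side t)), ‖F t w‖ ≤ bound (windowMap d (side t) w)) :
    Tendsto (fun t => ∑ w, F t w) atTop (𝓝 (∑' y, Finf y)) := by
  classical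
  simp_rw [sum_eq_tsum_window]
  refine tendsto_tsum_of_dominated_convergence hsum (fun y => ?_) (Eventually.of_forall fun t y => ?_)
  · have hxy : (fun t => F t (fun i => (y i : ZMod (side t))))
        =ᶠ[atTop] fun t => (if (∀ i, InWindow (side t) (y i)) then F t (siteOf d (side t) y) else 0) := by
      filter_upwards [eventually_inWindow hside y] with t ht
      rw [if_pos ht]; rfl
    exact (hF y).congr' hxy
  · by_cases hy : ∀ i, InWindow (side t) (y i)
    · rw [if_pos hy]
      have h := hbd t (siteOf d (side t) y)
      rwa [windowMap_siteOf d (side t) hy] at h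
    · rw [if_neg hy, norm_zero]; exact hb0 y

end Window

/-! ## §2 The window-distance inequality -/
/-- `|y − u| − 2|u| ≤ |symmRep ((y − u) mod s)|` for `y` in the window `]−s∕2, s∕2]`: the symmetric representative of `y − u` is `y − u` itself unless a wrap-around by a NON-ZERO multiple of
`s` occurs, and then it has modulus `≥ s − |y − u| ≥ |y| − |u|`. [folklore] -/
theorem abs_symmRep_sub_ge (s : ℕ) [NeZero s] {y : ℤ} (hy : InWindow s y) (u : ℤ) : |y - u| - 2 * |u| ≤ |symmRep s ((y - u : ℤ) : ZMod s)| := by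
  set r : ℤ := symmRep s ((y - u : ℤ) : ZMod s) with hr
  have hdvd : (s : ℤ) ∣ (y - u) - r := (ZMod.intCast_eq_intCast_iff_dvd_sub r (y - u) s).mp (by rw [hr, intCast_symmRep])
  obtain ⟨m, hm⟩ := hdvd
  have hrw : 2 * |r| ≤ s := two_mul_abs_symmRep_le s _
  have hyw : 2 * |y| ≤ s := by obtain ⟨h₁, h₂⟩ := hy; rcases abs_cases y with ⟨h, _⟩ | ⟨h, _⟩ <;> omega
  have h3 : |y - u| ≤ |y| + |u| := abs_sub y u
  by_cases hm0 : m = 0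
  · rw [hm0, mul_zero, sub_eq_zero] at hm
    rw [← hm]; linarith [abs_nonneg u]
  · have h1 : (s : ℤ) ≤ |(y - u) - r| := by
      rw [hm, abs_mul, abs_of_nonneg (Nat.cast_nonneg s)]
      have : (1 : ℤ) ≤ |m| := Int.one_le_abs hm0
      nlinarith [Nat.cast_nonneg (α := ℤ) s]
    have h2 : |(y - u) - r| ≤ |y - u| + |r| := abs_sub _ _
    linarith

/-- **`l1_windowMap_sub_castT_ge`**: `|windowMap w|₁ − 3|z|₁ ≤ |windowMap (w − ẑ)|₁` on the cubic torus `(ℤ∕s)^d` (coordinatewise §2 with `y = windowMap w`). [folklore] -/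
theorem l1_windowMap_sub_castT_ge (s : ℕ) [NeZero s] (w : Site d s) (z : Fin d → ℤ) :
    l1 (windowMap d s w) - 3 * l1 z ≤ l1 (windowMap d s (w - castT (cubic d s) z)) := by
  unfold l1
  rw [Finset.mul_sum, ← Finset.sum_sub_distrib]
  refine Finset.sum_le_sum fun i _ => ?_
  have hco : windowMap d s (w - castT (cubic d s) z) i = symmRep s ((windowMap d s w i - z i : ℤ) : ZMod s) := by
    simp only [windowMap, castT, Pi.sub_apply, Int.cast_sub, intCast_symmRep]
  have h := abs_symmRep_sub_ge s (inWindow_windowMap w i) (z i)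
  rw [← hco] at h
  have h' : (|(windowMap d s w i - z i : ℤ)| : ℝ) - 2 * |(z i : ℝ)| ≤ |(windowMap d s (w - castT (cubic d s) z) i : ℝ)| := by exact_mod_cast h
  have h3 : |(windowMap d s w i : ℝ)| - |(z i : ℝ)| ≤ |((windowMap d s w i - z i : ℤ) : ℝ)| := by
    rw [Int.cast_sub]; exact abs_sub_abs_le_abs_sub _ _
  linarith

/-- `|symmRep (−x)| = |symmRep x|` (the window `]−s∕2, s∕2]` is symmetric up to the point `s∕2`, which is its own negative mod `s`). [folklore] -/
theorem abs_symmRep_neg (s : ℕ) [NeZero s] (x : ZMod s) : |symmRep s (-x)| = |symmRep s x| := by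
  have hs : (0 : ℤ) < s := by exact_mod_cast Nat.pos_of_ne_zero (NeZero.ne s)
  have hdvd : (s : ℤ) ∣ 0 - (symmRep s x + symmRep s (-x)) := (ZMod.intCast_eq_intCast_iff_dvd_sub _ 0 s).mp (by
    rw [Int.cast_add, intCast_symmRep, intCast_symmRep, add_neg_cancel, Int.cast_zero])
  obtain ⟨m, hm⟩ := hdvd
  obtain ⟨h1a, h1b⟩ := Beta.inWindow_symmRep s x
  obtain ⟨h2a, h2b⟩ := Beta.inWindow_symmRep s (-x)
  have hlo : (s : ℤ) * (-1) < s * (-m) := by linarith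
  have hhi : (s : ℤ) * (-m) ≤ s * 1 := by linarith
  have hm1 : -1 < -m := lt_of_mul_lt_mul_left hlo hs.le
  have hm2 : -m ≤ 1 := le_of_mul_le_mul_left hhi hs
  have hm' : m = 0 ∨ m = -1 := by omega
  rcases hm' with rfl | rfl
  · have : symmRep s (-x) = -symmRep s x := by omega
    rw [this, abs_neg]
  · have : symmRep s (-x) = symmRep s x := by omega
    rw [this]

/-- `|windowMap (−v)|₁ = |windowMap v|₁`. [folklore] -/
theorem l1_windowMap_neg (s : ℕ) [NeZero s] (v : Site d s) : l1 (windowMap d s (-v)) = l1 (windowMap d s v) := by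
  unfold l1
  refine Finset.sum_congr rfl fun i _ => ?_
  have h := abs_symmRep_neg s (v i)
  have h' : (|(symmRep s (-v i) : ℤ)| : ℝ) = |(symmRep s (v i) : ℝ)| := by rw [← Int.cast_abs, h, Int.cast_abs]
  simpa [windowMap] using h'

/-! ## §3 Product closure of pair entry limits (no shift invariance) -/
section Pairs

variable (L : ℕ) [NeZero L] {side : ℕ → ℕ} [∀ t, NeZero (side t)]

/-- **`tendsto_mul_entry_pair` — EL₂ OF PRODUCTS, RIGHT FACTOR DECAYING** [folklore]: along `side t → ∞`, for volume-indexed families `X_t, Y_t` on the unit index sets read through `e`: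
`‖X_t(e(x,μ),e(w,λ))‖ ≤ B`, `‖Y_t(e(w,λ),e(y,ν))‖ ≤ C·e^{−δ|windowMap(w − y)|₁}` (`δ > 0`) and convergence of the entries of both at every PAIR of integer readings ⟹ the entries of `X_t·Y_t`
converge at every pair of integer readings (Tannery §1 with the majorant `B·C·e^{3δ|z′|₁}·e^{−δ|y|₁}` of §2). -/
theorem tendsto_mul_entry_pair (hside : Tendsto side atTop atTop) {X Y : (t : ℕ) → Matrix (idx L (cubic d (side t)) 0) (idx L (cubic d (side t)) 0) ℂ} {B C δ : ℝ}
    (hB : ∀ t (x : Site d (side t)) μ (w : Site d (side t)) l, ‖X t ((unitIdx L (cubic d (side t))).symm (x, μ)) ((unitIdx L (cubic d (side t))).symm (w, l))‖ ≤ B)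
    (hdec : ∀ t (w : Site d (side t)) l (y : Site d (side t)) ν, ‖Y t ((unitIdx L (cubic d (side t))).symm (w, l)) ((unitIdx L (cubic d (side t))).symm (y, ν))‖
      ≤ C * Real.exp (-δ * l1 (windowMap d (side t) (w - y)))) (hδ : 0 < δ)
    (hX : ∀ μ ν (z z' : Fin d → ℤ), ∃ s' : ℂ, Tendsto (fun t => X t ((unitIdx L (cubic d (side t))).symm (castT (cubic d (side t)) z, μ))
      ((unitIdx L (cubic d (side t))).symm (castT (cubic d (side t)) z', ν))) atTop (𝓝 s'))
    (hY : ∀ μ ν (z z' : Fin d → ℤ), ∃ s' : ℂ, Tendsto (fun t => Y t ((unitIdx L (cubic d (side t))).symm (castT (cubic d (side t)) z, μ))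
      ((unitIdx L (cubic d (side t))).symm (castT (cubic d (side t)) z', ν))) atTop (𝓝 s'))
    (μ ν : Fin d) (z z' : Fin d → ℤ) :
    ∃ s' : ℂ, Tendsto (fun t => (X t * Y t) ((unitIdx L (cubic d (side t))).symm (castT (cubic d (side t)) z, μ)) ((unitIdx L (cubic d (side t))).symm (castT (cubic d (side t)) z', ν)))
      atTop (𝓝 s') := by
  classical
  choose P hP using hX
  choose Q hQ using hY
  have hB0 : 0 ≤ B := (norm_nonneg _).trans (hB 0 0 μ 0 μ)
  have hC0 : 0 ≤ C := by
    have h := hdec 0 0 μ 0 μ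
    exact nonneg_of_mul_nonneg_left ((norm_nonneg _).trans h) (Real.exp_pos _)
  refine ⟨∑ l, ∑' y, P μ l z y * Q l ν y z', ?_⟩
  simp only [Matrix.mul_apply, sum_idx_eq_sum_site]
  refine tendsto_finsetSum _ fun l _ => ?_
  refine tendsto_sum_window hside (F := fun t w => X t ((unitIdx L (cubic d (side t))).symm (castT (cubic d (side t)) z, μ)) ((unitIdx L (cubic d (side t))).symm (w, l)) *
      Y t ((unitIdx L (cubic d (side t))).symm (w, l)) ((unitIdx L (cubic d (side t))).symm (castT (cubic d (side t)) z', ν)))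
    (fun y => (hP μ l z y).mul (hQ l ν y z')) (((summable_exp_neg_l1 hδ d).mul_left (B * C * Real.exp (δ * (3 * l1 z')))))
    (fun y => by positivity) fun t w => ?_
  rw [norm_mul]
  have h1 := hB t (castT (cubic d (side t)) z) μ w l
  have h2 := hdec t w l (castT (cubic d (side t)) z') ν
  have h3 := l1_windowMap_sub_castT_ge (side t) w z'
  have h4 : Real.exp (-δ * l1 (windowMap d (side t) (w - castT (cubic d (side t)) z'))) ≤ Real.exp (δ * (3 * l1 z')) * Real.exp (-δ * l1 (windowMap d (side t) w)) := by
    rw [← Real.exp_add]; exact Real.exp_le_exp.mpr (by nlinarith)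
  calc ‖X t _ _‖ * ‖Y t _ _‖ ≤ B * (C * Real.exp (-δ * l1 (windowMap d (side t) (w - castT (cubic d (side t)) z')))) := mul_le_mul h1 h2 (norm_nonneg _) hB0
    _ ≤ B * (C * (Real.exp (δ * (3 * l1 z')) * Real.exp (-δ * l1 (windowMap d (side t) w)))) := by gcongr
    _ = B * C * Real.exp (δ * (3 * l1 z')) * Real.exp (-δ * l1 (windowMap d (side t) w)) := by ring

/-- **`tendsto_mul_entry_pair'` — EL₂ OF PRODUCTS, LEFT FACTOR DECAYING** [folklore]: the mirrored form (`‖X_t(e(x,μ),e(w,λ))‖ ≤ C·e^{−δ|windowMap(w − x)|₁}`, `‖Y_t(e(w,λ),e(y,ν))‖ ≤ B`). -/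
theorem tendsto_mul_entry_pair' (hside : Tendsto side atTop atTop) {X Y : (t : ℕ) → Matrix (idx L (cubic d (side t)) 0) (idx L (cubic d (side t)) 0) ℂ} {B C δ : ℝ}
    (hdec : ∀ t (x : Site d (side t)) μ (w : Site d (side t)) l, ‖X t ((unitIdx L (cubic d (side t))).symm (x, μ)) ((unitIdx L (cubic d (side t))).symm (w, l))‖
      ≤ C * Real.exp (-δ * l1 (windowMap d (side t) (w - x)))) (hδ : 0 < δ)
    (hB : ∀ t (w : Site d (side t)) l (y : Site d (side t)) ν, ‖Y t ((unitIdx L (cubic d (side t))).symm (w, l)) ((unitIdx L (cubic d (side t))).symm (y, ν))‖ ≤ B)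
    (hX : ∀ μ ν (z z' : Fin d → ℤ), ∃ s' : ℂ, Tendsto (fun t => X t ((unitIdx L (cubic d (side t))).symm (castT (cubic d (side t)) z, μ))
      ((unitIdx L (cubic d (side t))).symm (castT (cubic d (side t)) z', ν))) atTop (𝓝 s'))
    (hY : ∀ μ ν (z z' : Fin d → ℤ), ∃ s' : ℂ, Tendsto (fun t => Y t ((unitIdx L (cubic d (side t))).symm (castT (cubic d (side t)) z, μ))
      ((unitIdx L (cubic d (side t))).symm (castT (cubic d (side t)) z', ν))) atTop (𝓝 s'))
    (μ ν : Fin d) (z z' : Fin d → ℤ) :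
    ∃ s' : ℂ, Tendsto (fun t => (X t * Y t) ((unitIdx L (cubic d (side t))).symm (castT (cubic d (side t)) z, μ)) ((unitIdx L (cubic d (side t))).symm (castT (cubic d (side t)) z', ν)))
      atTop (𝓝 s') := by
  classical
  choose P hP using hX
  choose Q hQ using hY
  have hB0 : 0 ≤ B := (norm_nonneg _).trans (hB 0 0 μ 0 μ)
  have hC0 : 0 ≤ C := by
    have h := hdec 0 0 μ 0 μ
    exact nonneg_of_mul_nonneg_left ((norm_nonneg _).trans h) (Real.exp_pos _)
  refine ⟨∑ l, ∑' y, P μ l z y * Q l ν y z', ?_⟩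
  simp only [Matrix.mul_apply, sum_idx_eq_sum_site]
  refine tendsto_finsetSum _ fun l _ => ?_
  refine tendsto_sum_window hside (F := fun t w => X t ((unitIdx L (cubic d (side t))).symm (castT (cubic d (side t)) z, μ)) ((unitIdx L (cubic d (side t))).symm (w, l)) *
      Y t ((unitIdx L (cubic d (side t))).symm (w, l)) ((unitIdx L (cubic d (side t))).symm (castT (cubic d (side t)) z', ν)))
    (fun y => (hP μ l z y).mul (hQ l ν y z')) (((summable_exp_neg_l1 hδ d).mul_left (C * B * Real.exp (δ * (3 * l1 z)))))
    (fun y => by positivity) fun t w => ?_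
  rw [norm_mul]
  have h1 := hdec t (castT (cubic d (side t)) z) μ w l
  have h2 := hB t w l (castT (cubic d (side t)) z') ν
  have h3 := l1_windowMap_sub_castT_ge (side t) w z
  have h4 : Real.exp (-δ * l1 (windowMap d (side t) (w - castT (cubic d (side t)) z))) ≤ Real.exp (δ * (3 * l1 z)) * Real.exp (-δ * l1 (windowMap d (side t) w)) := by
    rw [← Real.exp_add]; exact Real.exp_le_exp.mpr (by nlinarith)
  calc ‖X t _ _‖ * ‖Y t _ _‖ ≤ (C * Real.exp (-δ * l1 (windowMap d (side t) (w - castT (cubic d (side t)) z)))) * B := mul_le_mul h1 h2 (norm_nonneg _) (by positivity)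
    _ ≤ (C * (Real.exp (δ * (3 * l1 z)) * Real.exp (-δ * l1 (windowMap d (side t) w)))) * B := by gcongr
    _ = C * B * Real.exp (δ * (3 * l1 z)) * Real.exp (-δ * l1 (windowMap d (side t) w)) := by ring

end Pairs

/-! ## §4 The effective form at pairs: window decay (volume-free) and pair entry limits -/
section EffForm

variable (L : ℕ) [NeZero L]

omit [NeZero L] in
/-- the torus distance is translation invariant: `tdist w y = tdist (w − y) 0`. [folklore] -/
theorem tdist_eq_tdist_sub_zero {s : ℕ} (w y : Site d s) : tdist (N := cubic d s) w y = tdist (N := cubic d s) (w - y) 0 := by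
  unfold tdist; rw [zero_sub, neg_sub]

/-- **(UD) in `distK` ⟹ window decay AT PAIRS**: `EntryDecay distK X B δ` (`δ ≥ 0`) on the unit index set of `(ℤ∕s)^d` gives `‖X(e(w,λ), e(y,ν))‖ ≤ B·e^{−(δ∕d)|windowMap(w − y)|₁}`. [folklore] -/
theorem norm_le_exp_window_of_entryDecay (s : ℕ) [NeZero s] {X : Matrix (idx L (cubic d s) 0) (idx L (cubic d s) 0) ℂ} {B δ : ℝ} (hδ : 0 ≤ δ) (hX : EntryDecay (distK L (cubic d s)) X B δ)
    (w : Site d s) (l : Fin d) (y : Site d s) (ν : Fin d) :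
    ‖X ((unitIdx L (cubic d s)).symm (w, l)) ((unitIdx L (cubic d s)).symm (y, ν))‖ ≤ B * Real.exp (-(δ / d) * l1 (windowMap d s (w - y))) := by
  have hB : 0 ≤ B := by
    have := (norm_nonneg _).trans (hX ((unitIdx L (cubic d s)).symm (w, l)) ((unitIdx L (cubic d s)).symm (w, l)))
    exact nonneg_of_mul_nonneg_left this (Real.exp_pos _)
  have h := hX ((unitIdx L (cubic d s)).symm (w, l)) ((unitIdx L (cubic d s)).symm (y, ν))
  have hdist : distK L (cubic d s) ((unitIdx L (cubic d s)).symm (w, l)) ((unitIdx L (cubic d s)).symm (y, ν))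
      = distK L (cubic d s) ((unitIdx L (cubic d s)).symm (w - y, l)) ((unitIdx L (cubic d s)).symm (0, ν)) := by
    rw [distK_unitIdx_symm, distK_unitIdx_symm, tdist_eq_tdist_sub_zero]
  rw [hdist] at h
  exact h.trans (mul_le_mul_of_nonneg_left (exp_distK_le_exp_window L s hδ (w - y) l ν) hB)

variable (a : ℝ) (ha : 0 < a)

/-- **`effForm_pair_bounds` — THE EFFECTIVE FORM AT PAIRS, VOLUME-FREE** (`L ≥ 2`, `d ≥ 2`): `∃ κ′ > 0, Bs ≥ 0` (from `(d, L, a)`, PART 132's) with, for every cubic torus, level and pair,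
`‖Σ_k(e(w,λ), e(y,ν))‖ ≤ Bs` and `‖Σ_k(e(w,λ), e(y,ν))‖ ≤ Bs·e^{−(κ′∕d)|windowMap(w − y)|₁}`. [folklore] -/
theorem effForm_pair_bounds (hL : 2 ≤ L) (hd : 2 ≤ d) :
    ∃ κ' Bs : ℝ, 0 < κ' ∧ 0 ≤ Bs ∧ ∀ (s : ℕ) [NeZero s] (k : ℕ) (w : Site d s) (l : Fin d) (y : Site d s) (ν : Fin d),
      ‖((unitCovB L (cubic d s) a ha k)⁻¹ - (a : ℂ) • (1 : Matrix (idx L (cubic d s) 0) (idx L (cubic d s) 0) ℂ)) ((unitIdx L (cubic d s)).symm (w, l)) ((unitIdx L (cubic d s)).symm (y, ν))‖ ≤ Bs ∧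
      ‖((unitCovB L (cubic d s) a ha k)⁻¹ - (a : ℂ) • (1 : Matrix (idx L (cubic d s) 0) (idx L (cubic d s) 0) ℂ)) ((unitIdx L (cubic d s)).symm (w, l)) ((unitIdx L (cubic d s)).symm (y, ν))‖
        ≤ Bs * Real.exp (-(κ' / d) * l1 (windowMap d s (w - y))) := by
  obtain ⟨κ', Bs, Bs', hκ', hBs, -, h⟩ := decay_effForm L a ha hL hd
  have hd0 : (0 : ℝ) < d := by exact_mod_cast lt_of_lt_of_le zero_lt_two hd
  refine ⟨κ', Bs, hκ', hBs, fun s _ k w l y ν => ?_⟩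
  have h2 := norm_le_exp_window_of_entryDecay L s hκ'.le ((h (cubic d s)).1 k) w l y ν
  refine ⟨h2.trans ?_, h2⟩
  have : Real.exp (-(κ' / d) * l1 (windowMap d s (w - y))) ≤ 1 := by
    rw [Real.exp_le_one_iff, neg_mul, neg_nonpos]
    exact mul_nonneg (div_pos hκ' hd0).le (Finset.sum_nonneg fun i _ => abs_nonneg _)
  simpa using mul_le_mul_of_nonneg_left this hBs

/-! ## §5 The vertex socket: `Σ_k·D·Σ_k` on `ℤ^d` modulo the vertex's (UD)+(SR)+EL₂ -/

/-- **`conv_sandwich_effForm_of_vertex` — THE VERTEX SOCKET** [our proof] (`d ≥ 3`, `L ≥ 2`, `a > 0`, `μ ≠ ν`, along the even cubic volumes `side t = 2(t+1)`): for ANY volume-indexed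
family of vertex kernels `D_t k` on the unit index sets with (UD) `EntryDecay distK (D_t k) B_D κ_D`, (SR) `TwoLevelDecayRate distK (D_t ·) B_D′ κ_D (√(L⁻¹))` (`κ_D > 0`; constants free of
`t, k`) and EL₂ (its entries converge at every pair of integer readings), the sandwich `Σ_k·D_t k·Σ_k` has: limit kernels `Π_k` with `IsInfiniteVolumeLimit evenPeriod (Re (Σ_k D_t k Σ_k)(e(·,μ′),e(0,ν′))) (Π k)`,
`UniformDecay Π μ ν B (κ∕d)`, `StepRate Π μ ν B′ (κ∕d) (√(L⁻¹))`, `KernelInputs d Π`, and `∀ k, |secondMoment (Π k) μ ν − secondMoment (limKernelOf Π) μ ν| ≤ β′_d(B′∕(1−√(L⁻¹)), κ∕d)·(√(L⁻¹))^k`,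
with `κ > 0`, `B, B′ ≥ 0` depending on `(d, L, a, B_D, B_D′, κ_D)` only — (UD)+(SR) by PART 130's product rules (twice, at the common rate `min κ′ κ_D`), EL₂ by §3 (twice: `Σ_k` decays on
the left, then on the right), END by PART 140 §1.  The vertex is the ONLY displayed input. [cite: Balaban1987RG1, (1.21)–(1.22) p.264 (shapes)] -/
theorem conv_sandwich_effForm_of_vertex (hL : 2 ≤ L) (hd : 3 ≤ d) {μ ν : Fin d} (hne : μ ≠ ν)
    {D : (t : ℕ) → ℕ → Matrix (idx L (cubic d (evenPeriod t)) 0) (idx L (cubic d (evenPeriod t)) 0) ℂ} {BD BD' κD : ℝ} (hκD : 0 < κD) (hBD : 0 ≤ BD) (hBD' : 0 ≤ BD')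
    (hDud : ∀ t k, EntryDecay (distK L (cubic d (evenPeriod t))) (D t k) BD κD)
    (hDsr : ∀ t, TwoLevelDecayRate (distK L (cubic d (evenPeriod t))) (D t) BD' κD (Real.sqrt ((L : ℝ)⁻¹)))
    (hDel : ∀ k μ ν (z z' : Fin d → ℤ), ∃ s' : ℂ, Tendsto (fun t => D t k ((unitIdx L (cubic d (evenPeriod t))).symm (castT (cubic d (evenPeriod t)) z, μ))
      ((unitIdx L (cubic d (evenPeriod t))).symm (castT (cubic d (evenPeriod t)) z', ν))) atTop (𝓝 s')) :
    ∃ κ B B' : ℝ, 0 < κ ∧ 0 ≤ B ∧ 0 ≤ B' ∧ ∃ Pinf : ℕ → B12Beta.Kernel d,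
      (∀ k, IsInfiniteVolumeLimit evenPeriod
        (fun t μ' ν' (z : Site d (evenPeriod t)) =>
          ((((unitCovB L (cubic d (evenPeriod t)) a ha k)⁻¹ - (a : ℂ) • (1 : Matrix (idx L (cubic d (evenPeriod t)) 0) (idx L (cubic d (evenPeriod t)) 0) ℂ)) * D t k *
            ((unitCovB L (cubic d (evenPeriod t)) a ha k)⁻¹ - (a : ℂ) • (1 : Matrix (idx L (cubic d (evenPeriod t)) 0) (idx L (cubic d (evenPeriod t)) 0) ℂ)))
            ((unitIdx L (cubic d (evenPeriod t))).symm (z, μ')) ((unitIdx L (cubic d (evenPeriod t))).symm (0, ν'))).re) (Pinf k)) ∧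
      Beta.LimitRate.UniformDecay Pinf μ ν B (κ / d) ∧ StepRate Pinf μ ν B' (κ / d) (Real.sqrt ((L : ℝ)⁻¹)) ∧
      (∃ K : KernelInputs d Pinf, K.θ = Real.sqrt ((L : ℝ)⁻¹) ∧ K.c₀ = betaPrime510 d (B' / (1 - Real.sqrt ((L : ℝ)⁻¹))) (κ / d) ∧ K.Pinf = limKernelOf Pinf ∧ K.μ = μ ∧ K.ν = ν) ∧
      (∀ k, |B12Beta.secondMoment (Pinf k) μ ν - B12Beta.secondMoment (limKernelOf Pinf) μ ν|
          ≤ betaPrime510 d (B' / (1 - Real.sqrt ((L : ℝ)⁻¹))) (κ / d) * Real.sqrt ((L : ℝ)⁻¹) ^ k) := by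
  have hd1 : 1 ≤ d := le_trans (by norm_num) hd
  have hd2 : 2 ≤ d := le_trans (by norm_num) hd
  have hd0 : (0 : ℝ) < d := by exact_mod_cast lt_of_lt_of_le zero_lt_one hd1
  obtain ⟨κ', Bs, Bs', hκ', hBs, hBs', h⟩ := decay_effForm L a ha hL hd2
  -- common rate `κ₀ = min κ′ κ_D`, then the two product steps of PART 130 (rates κ₀ ↦ κ₀/2 ↦ κ₀/4)
  set κ₀ : ℝ := min κ' κD with hκ₀
  have hκ₀0 : 0 < κ₀ := lt_min hκ' hκD
  obtain ⟨S₁, hS₁0, hS₁⟩ := sum_exp_distK_le (d := d) hd2 (half_pos hκ₀0)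
  obtain ⟨S₂, hS₂0, hS₂⟩ := sum_exp_distK_le (d := d) hd2 (half_pos (half_pos hκ₀0))
  have hL1 : (1 : ℝ) < L := by exact_mod_cast (lt_of_lt_of_le one_lt_two hL : 1 < L)
  have hθ0 : 0 ≤ Real.sqrt ((L : ℝ)⁻¹) := Real.sqrt_nonneg _
  have hθ1 : Real.sqrt ((L : ℝ)⁻¹) < 1 := by
    rw [show (1 : ℝ) = Real.sqrt 1 from Real.sqrt_one.symm]
    exact Real.sqrt_lt_sqrt (inv_nonneg.mpr (Nat.cast_nonneg _)) (inv_lt_one_of_one_lt₀ hL1)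
  -- (UD)+(SR) of the three towers at the common rate κ₀
  have hSud : ∀ t k, EntryDecay (distK L (cubic d (evenPeriod t)))
      ((unitCovB L (cubic d (evenPeriod t)) a ha k)⁻¹ - (a : ℂ) • (1 : Matrix (idx L (cubic d (evenPeriod t)) 0) (idx L (cubic d (evenPeriod t)) 0) ℂ)) Bs κ₀ :=
    fun t k x y => ((h (cubic d (evenPeriod t))).1 k x y).trans (mul_le_mul_of_nonneg_left (Real.exp_le_exp.mpr (by
      have := distK_nonneg L (cubic d (evenPeriod t)) x y; nlinarith [min_le_left κ' κD])) hBs)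
  have hSsr : ∀ t, TwoLevelDecayRate (distK L (cubic d (evenPeriod t)))
      (fun k => (unitCovB L (cubic d (evenPeriod t)) a ha k)⁻¹ - (a : ℂ) • (1 : Matrix (idx L (cubic d (evenPeriod t)) 0) (idx L (cubic d (evenPeriod t)) 0) ℂ)) Bs' κ₀ (Real.sqrt ((L : ℝ)⁻¹)) :=
    fun t k x y => ((h (cubic d (evenPeriod t))).2 k x y).trans (mul_le_mul_of_nonneg_left (Real.exp_le_exp.mpr (by
      have := distK_nonneg L (cubic d (evenPeriod t)) x y; nlinarith [min_le_left κ' κD])) (by positivity))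
  have hDud' : ∀ t k, EntryDecay (distK L (cubic d (evenPeriod t))) (D t k) BD κ₀ :=
    fun t k x y => (hDud t k x y).trans (mul_le_mul_of_nonneg_left (Real.exp_le_exp.mpr (by
      have := distK_nonneg L (cubic d (evenPeriod t)) x y; nlinarith [min_le_right κ' κD])) hBD)
  have hDsr' : ∀ t, TwoLevelDecayRate (distK L (cubic d (evenPeriod t))) (D t) BD' κ₀ (Real.sqrt ((L : ℝ)⁻¹)) :=
    fun t k x y => (hDsr t k x y).trans (mul_le_mul_of_nonneg_left (Real.exp_le_exp.mpr (by
      have := distK_nonneg L (cubic d (evenPeriod t)) x y; nlinarith [min_le_right κ' κD])) (by positivity))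
  -- first product `Σ·D` at rate κ₀/2, second `(Σ·D)·Σ` at rate κ₀/4
  have hPud : ∀ t k, EntryDecay (distK L (cubic d (evenPeriod t)))
      (((unitCovB L (cubic d (evenPeriod t)) a ha k)⁻¹ - (a : ℂ) • (1 : Matrix (idx L (cubic d (evenPeriod t)) 0) (idx L (cubic d (evenPeriod t)) 0) ℂ)) * D t k) (Bs * BD * (d * S₁)) (κ₀ / 2) :=
    fun t k => entryDecay_mul_tower (distK_nonneg L (cubic d (evenPeriod t))) (distK_triangle L (cubic d (evenPeriod t))) hκ₀0.le (hS₁ L (cubic d (evenPeriod t))) (hSud t) (hDud' t) k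
  have hPsr : ∀ t, TwoLevelDecayRate (distK L (cubic d (evenPeriod t)))
      (fun k => ((unitCovB L (cubic d (evenPeriod t)) a ha k)⁻¹ - (a : ℂ) • (1 : Matrix (idx L (cubic d (evenPeriod t)) 0) (idx L (cubic d (evenPeriod t)) 0) ℂ)) * D t k)
      ((Bs' * BD + Bs * BD') * (d * S₁)) (κ₀ / 2) (Real.sqrt ((L : ℝ)⁻¹)) :=
    fun t => twoLevelDecayRate_mul (distK_nonneg L (cubic d (evenPeriod t))) (distK_triangle L (cubic d (evenPeriod t))) hκ₀0.le (hS₁ L (cubic d (evenPeriod t)))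
      (hSud t) (hDud' t) (hSsr t) (hDsr' t)
  have hSud2 : ∀ t k, EntryDecay (distK L (cubic d (evenPeriod t)))
      ((unitCovB L (cubic d (evenPeriod t)) a ha k)⁻¹ - (a : ℂ) • (1 : Matrix (idx L (cubic d (evenPeriod t)) 0) (idx L (cubic d (evenPeriod t)) 0) ℂ)) Bs (κ₀ / 2) :=
    fun t k x y => (hSud t k x y).trans (mul_le_mul_of_nonneg_left (Real.exp_le_exp.mpr (by
      have := distK_nonneg L (cubic d (evenPeriod t)) x y; nlinarith)) hBs)
  have hSsr2 : ∀ t, TwoLevelDecayRate (distK L (cubic d (evenPeriod t)))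
      (fun k => (unitCovB L (cubic d (evenPeriod t)) a ha k)⁻¹ - (a : ℂ) • (1 : Matrix (idx L (cubic d (evenPeriod t)) 0) (idx L (cubic d (evenPeriod t)) 0) ℂ)) Bs' (κ₀ / 2) (Real.sqrt ((L : ℝ)⁻¹)) :=
    fun t k x y => (hSsr t k x y).trans (mul_le_mul_of_nonneg_left (Real.exp_le_exp.mpr (by
      have := distK_nonneg L (cubic d (evenPeriod t)) x y; nlinarith)) (by positivity))
  have hud : ∀ t k, EntryDecay (distK L (cubic d (evenPeriod t)))
      (((unitCovB L (cubic d (evenPeriod t)) a ha k)⁻¹ - (a : ℂ) • (1 : Matrix (idx L (cubic d (evenPeriod t)) 0) (idx L (cubic d (evenPeriod t)) 0) ℂ)) * D t k *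
        ((unitCovB L (cubic d (evenPeriod t)) a ha k)⁻¹ - (a : ℂ) • (1 : Matrix (idx L (cubic d (evenPeriod t)) 0) (idx L (cubic d (evenPeriod t)) 0) ℂ)))
      (Bs * BD * (d * S₁) * Bs * (d * S₂)) (κ₀ / 2 / 2) :=
    fun t k => entryDecay_mul_tower (distK_nonneg L (cubic d (evenPeriod t))) (distK_triangle L (cubic d (evenPeriod t))) (half_pos hκ₀0).le (hS₂ L (cubic d (evenPeriod t)))
      (hPud t) (hSud2 t) k
  have hsr : ∀ t, TwoLevelDecayRate (distK L (cubic d (evenPeriod t)))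
      (fun k => ((unitCovB L (cubic d (evenPeriod t)) a ha k)⁻¹ - (a : ℂ) • (1 : Matrix (idx L (cubic d (evenPeriod t)) 0) (idx L (cubic d (evenPeriod t)) 0) ℂ)) * D t k *
        ((unitCovB L (cubic d (evenPeriod t)) a ha k)⁻¹ - (a : ℂ) • (1 : Matrix (idx L (cubic d (evenPeriod t)) 0) (idx L (cubic d (evenPeriod t)) 0) ℂ)))
      (((Bs' * BD + Bs * BD') * (d * S₁) * Bs + Bs * BD * (d * S₁) * Bs') * (d * S₂)) (κ₀ / 2 / 2) (Real.sqrt ((L : ℝ)⁻¹)) :=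
    fun t => twoLevelDecayRate_mul (distK_nonneg L (cubic d (evenPeriod t))) (distK_triangle L (cubic d (evenPeriod t))) (half_pos hκ₀0).le (hS₂ L (cubic d (evenPeriod t)))
      (hPud t) (hSud2 t) (hPsr t) (hSsr2 t)
  refine ⟨κ₀ / 2 / 2, Bs * BD * (d * S₁) * Bs * (d * S₂), ((Bs' * BD + Bs * BD') * (d * S₁) * Bs + Bs * BD * (d * S₁) * Bs') * (d * S₂),
    half_pos (half_pos hκ₀0), by positivity, by positivity, ?_⟩
  refine conv_of_decay_of_tendsto L hd1 tendsto_evenPeriod (half_pos (half_pos hκ₀0)) hθ0 hθ1 hud hsr ?_ hne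
  -- EL at the origin pairs from EL₂ of the sandwich (§3 twice)
  intro k μ' ν' z
  obtain ⟨κ₁, B₁, hκ₁, hB₁, hb⟩ := effForm_pair_bounds L a ha hL hd2
  have hSel := fun μ ν z z' => tendsto_effForm_entry L a ha hd k μ ν z z'
  -- EL₂ of `Σ·D` (left factor decaying, right factor bounded by `B_D`)
  have hBDb : ∀ t (w : Site d (evenPeriod t)) l (y : Site d (evenPeriod t)) ν, ‖D t k ((unitIdx L (cubic d (evenPeriod t))).symm (w, l)) ((unitIdx L (cubic d (evenPeriod t))).symm (y, ν))‖ ≤ BD :=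
    fun t w l y ν => (hDud t k _ _).trans (by
      have : Real.exp (-(κD * distK L (cubic d (evenPeriod t)) ((unitIdx L (cubic d (evenPeriod t))).symm (w, l)) ((unitIdx L (cubic d (evenPeriod t))).symm (y, ν)))) ≤ 1 := by
        rw [Real.exp_le_one_iff, neg_nonpos]; exact mul_nonneg hκD.le (distK_nonneg L _ _ _)
      simpa using mul_le_mul_of_nonneg_left this hBD)
  have hSD := tendsto_mul_entry_pair' L tendsto_evenPeriod
    (X := fun t => (unitCovB L (cubic d (evenPeriod t)) a ha k)⁻¹ - (a : ℂ) • (1 : Matrix (idx L (cubic d (evenPeriod t)) 0) (idx L (cubic d (evenPeriod t)) 0) ℂ))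
    (Y := fun t => D t k) (fun t x μ w l => by
      have := (hb (evenPeriod t) k x μ w l).2
      rwa [show x - w = -(w - x) from (neg_sub w x).symm, l1_windowMap_neg] at this) (div_pos hκ₁ hd0) hBDb hSel (hDel k)
  have hSDb : ∀ t (x : Site d (evenPeriod t)) μ (w : Site d (evenPeriod t)) l,
      ‖(((unitCovB L (cubic d (evenPeriod t)) a ha k)⁻¹ - (a : ℂ) • (1 : Matrix (idx L (cubic d (evenPeriod t)) 0) (idx L (cubic d (evenPeriod t)) 0) ℂ)) * D t k)
        ((unitIdx L (cubic d (evenPeriod t))).symm (x, μ)) ((unitIdx L (cubic d (evenPeriod t))).symm (w, l))‖ ≤ Bs * BD * (d * S₁) :=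
    fun t x μ w l => (hPud t k _ _).trans (by
      have : Real.exp (-(κ₀ / 2 * distK L (cubic d (evenPeriod t)) ((unitIdx L (cubic d (evenPeriod t))).symm (x, μ)) ((unitIdx L (cubic d (evenPeriod t))).symm (w, l)))) ≤ 1 := by
        rw [Real.exp_le_one_iff, neg_nonpos]; exact mul_nonneg (half_pos hκ₀0).le (distK_nonneg L _ _ _)
      have h0 : 0 ≤ Bs * BD * (d * S₁) := by positivity
      simpa using mul_le_mul_of_nonneg_left this h0)
  exact tendsto_mul_entry_pair L tendsto_evenPeriod (X := fun t => ((unitCovB L (cubic d (evenPeriod t)) a ha k)⁻¹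
      - (a : ℂ) • (1 : Matrix (idx L (cubic d (evenPeriod t)) 0) (idx L (cubic d (evenPeriod t)) 0) ℂ)) * D t k)
    (Y := fun t => (unitCovB L (cubic d (evenPeriod t)) a ha k)⁻¹ - (a : ℂ) • (1 : Matrix (idx L (cubic d (evenPeriod t)) 0) (idx L (cubic d (evenPeriod t)) 0) ℂ))
    hSDb (fun t w l y ν => (hb (evenPeriod t) k w l y ν).2) (div_pos hκ₁ hd0) hSD hSel μ' ν' z 0 |>.imp fun s' hs' => by
      have e0 : ∀ t, castT (cubic d (evenPeriod t)) (0 : Fin d → ℤ) = 0 := fun t => by funext i; simp [castT]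
      simpa only [e0] using hs'

end EffForm

end Summit.QuantumFields.BalabanUV.Beta.GAN24.DiagramVolumeLimitPairs

end
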